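/-
Copyright (c) 2026 the pub-hodgecm-mathlib formalisation cell (harness21).  Prover seat hodgecm-mathlib-K2E3-p03 (g4), Track B «K2-LIT» ∕ h413
(`stmt-HodgeConjecture-24833`), line `K2_E3_EllipticInputs`, unit U12, §L leaf (LBGL-3E) (Richardson road, (F-E) ROAD v2 of K2E3-p11 (g5)), brick S″:
A `3 × 3` MATRIX WITH A SIMPLE RATIONAL EIGENVALUE `λ` IS CONJUGATE OVER THE GROUND FIELD TO A (2,1)-LEVI BLOCK FORM `[[A, 0], [0, λ]]`.  2026-09-04.
-/
import Mathlib.LinearAlgebra.Matrix.Charpoly.Coeff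
import Mathlib.LinearAlgebra.Matrix.ToLinearEquiv
import Mathlib.Algebra.Polynomial.Derivative
import HarnessLib

/-!
# K2_E3 road (h413), §L leaf (LBGL-3E), (F-E) ROAD v2 brick S″ — the Levi block form at a simple rational eigenvalue (`3 × 3`, any field)

Cell `pub/hodgecm-mathlib` (D-0151), Track B (21-frontier RULING «PUSH BOTH» 2026-09-03, director req624), seat K2E3-p03 (g4); by-name deal (2) of the
Richardson road owner K2E3-p11 (g5), squad bus 2026-09-04T06:00:55Z («S″, the `r = 1` twin of ★ (J0) `exists_conj_diagonal_of_card_roots_eq_three`»).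
`--supports stmt-HodgeConjecture-24833 --as helper`; THEOREMS ONLY (no definition ∕ instance ∕ notation ∕ named fact ∕ `sorry`); never imports `Cruxes/…/Lines`.
COUNT-NEUTRAL: (LBGL-3E) `sig_K2E3GL3ParabolicSliceDensity` stays OPEN; S″ places a regular semisimple `X₀` with ONE rational root in the chart centre `M(m)` of
★ E″ `K2E3GL3ParabolicChartDeriv` ∕ G″.

THE RESULT (`K` ANY field).  Write `M(m) = !![m 0, m 1, 0; m 2, m 3, 0; 0, 0, m 4]` (`m : Fin 5 → K`) and `A(m) = !![m 0, m 1; m 2, m 3]`.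
* **`exists_conj_leviBlock_of_isRoot_of_derivative_ne_zero`** — if `λ ∈ K` is a SIMPLE root of `χ_X` (`χ_X(λ) = 0`, `χ_X′(λ) ≠ 0`), `X ∈ 𝔤𝔩₃(K)`, then
  `X = g · M(m) · g⁻¹` for some `g ∈ GL₃(K)` and `m` with `m 4 = λ`;
* riders `charpoly_leviBlock (m) : χ_{M(m)} = χ_{A(m)} · (X − C (m 4))`, `derivative_charpoly_leviBlock_eval (m) : χ_{M(m)}′(m 4) = χ_{A(m)}(m 4)` (so along the fibre
  `W_𝔭 = c·Σ_λ ‖χ′(λ)‖⁻¹ = c·Σ_j ‖χ(m_j)‖⁻¹`), and the general `charpoly_eq_of_col_two_eq_zero` ∕ `derivative_charpoly_eval_of_col_two_eq_zero` for any `Y` with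
  `Y 0 2 = Y 1 2 = 0`.
PROOF (dimension-theory-free, explicit `3 × 3` algebra).  (1) An eigenvector `v ≠ 0`, `X v = λ v` (`Matrix.eval_charpoly`, `Matrix.exists_mulVec_eq_zero_iff`).
(2) `g₁ ∈ GL₃(K)` with last column `v` (a non-zero coordinate of `v` and two standard basis vectors).  (3) `X₁ := g₁⁻¹ X g₁` has last column `(0, 0, λ)ᵀ`, i.e.
`X₁ = [[A, 0], [r, λ]]`, so `χ_X = χ_{X₁} = χ_A · (t − λ)` and `χ_X′(λ) = χ_A(λ) = det(λ·1 − A) ≠ 0`.  (4) The shear `h = [[1, 0], [z, 1]]` with `z (λ·1 − A) = r`,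
i.e. `z := r · (λ·1 − A)⁻¹`, gives `h X₁ h⁻¹ = [[A, 0], [0, λ]] = M(m)`; `g := g₁ h⁻¹`.
[HarishChandra1999AdmissibleDistributions, §7 (block-regular elements of a Levi subalgebra); folklore linear algebra]
HONEST LABEL: HC_CM is proved only modulo the 7 printed citations (2 remaining named inputs: hLiu418 = stmt-HodgeConjecture-24832, h413 =
stmt-HodgeConjecture-24833) until rung 0 closes; count-neutral helper.

## References
* [HarishChandra1999AdmissibleDistributions] Harish-Chandra (DeBacker–Sally), *Admissible Invariant Distributions on Reductive p-adic Groups* (1999), §7.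
-/

set_option autoImplicit false
set_option linter.dupNamespace false   -- `Summit.HodgeConjecture.HodgeConjecture.…` (D-0017 nested layout; lakefile exemption for Summits)

noncomputable section

open Polynomial
open scoped Matrix MatrixGroups

namespace Summit.HodgeConjecture.HodgeConjecture.Cruxes.H413.K2E3GL3SimpleEigenvalueLeviForm

/-! ## §1  Characteristic polynomial of a `3 × 3` matrix with last column `(0, 0, *)ᵀ` (any commutative ring) -/

section Charpoly

variable {R : Type*} [CommRing R]

/-- **`χ_Y = χ_A · (X − C y₂₂)`** for `Y ∈ 𝔤𝔩₃(R)` with `Y 0 2 = Y 1 2 = 0` and `A` its upper-left `2 × 2` block. [folklore] -/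
theorem charpoly_eq_of_col_two_eq_zero (Y : Matrix (Fin 3) (Fin 3) R) (h0 : Y 0 2 = 0) (h1 : Y 1 2 = 0) :
    Y.charpoly = (!![Y 0 0, Y 0 1; Y 1 0, Y 1 1] : Matrix (Fin 2) (Fin 2) R).charpoly * (X - C (Y 2 2)) := by
  rw [Matrix.charpoly, Matrix.charpoly, Matrix.det_fin_three, Matrix.det_fin_two]
  simp [h0, h1]
  ring

/-- `χ_Y′(y₂₂) = χ_A(y₂₂)` for such `Y`. [folklore] -/
theorem derivative_charpoly_eval_of_col_two_eq_zero (Y : Matrix (Fin 3) (Fin 3) R) (h0 : Y 0 2 = 0) (h1 : Y 1 2 = 0) :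
    Y.charpoly.derivative.eval (Y 2 2) = (!![Y 0 0, Y 0 1; Y 1 0, Y 1 1] : Matrix (Fin 2) (Fin 2) R).charpoly.eval (Y 2 2) := by
  rw [charpoly_eq_of_col_two_eq_zero Y h0 h1, derivative_mul]
  simp

/-- **`χ_{M(m)} = χ_{A(m)} · (X − C (m 4))`** for the Levi block form `M(m) = !![m 0, m 1, 0; m 2, m 3, 0; 0, 0, m 4]`. [folklore] -/
theorem charpoly_leviBlock (m : Fin 5 → R) :
    (!![m 0, m 1, 0; m 2, m 3, 0; 0, 0, m 4] : Matrix (Fin 3) (Fin 3) R).charpoly =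
      (!![m 0, m 1; m 2, m 3] : Matrix (Fin 2) (Fin 2) R).charpoly * (X - C (m 4)) := by
  have h := charpoly_eq_of_col_two_eq_zero (!![m 0, m 1, 0; m 2, m 3, 0; 0, 0, m 4] : Matrix (Fin 3) (Fin 3) R) (by simp) (by simp)
  simpa using h

/-- **`χ_{M(m)}′(m 4) = χ_{A(m)}(m 4)`**: at the rational root `m 4` the derivative of the characteristic polynomial is the Levi-block value `χ_A(m 4)`
(the weight of the fibre point in `W_𝔭`). [folklore] -/
theorem derivative_charpoly_leviBlock_eval (m : Fin 5 → R) :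
    (!![m 0, m 1, 0; m 2, m 3, 0; 0, 0, m 4] : Matrix (Fin 3) (Fin 3) R).charpoly.derivative.eval (m 4) =
      (!![m 0, m 1; m 2, m 3] : Matrix (Fin 2) (Fin 2) R).charpoly.eval (m 4) := by
  have h := derivative_charpoly_eval_of_col_two_eq_zero (!![m 0, m 1, 0; m 2, m 3, 0; 0, 0, m 4] : Matrix (Fin 3) (Fin 3) R) (by simp) (by simp)
  simpa using h

end Charpoly

/-! ## §2  The Levi block form at a simple rational eigenvalue (any field) -/

section Field

variable {K : Type*} [Field K]

/-- A non-zero vector of `K³` is the last column of an invertible matrix. [folklore] -/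
theorem exists_gl_apply_two_eq {v : Fin 3 → K} (hv : v ≠ 0) : ∃ g : GL (Fin 3) K, ∀ i, (g : Matrix (Fin 3) (Fin 3) K) i 2 = v i := by
  obtain ⟨a, ha⟩ : ∃ a, v a ≠ 0 := by
    by_contra h
    push Not at h
    exact hv (funext h)
  fin_cases a
  · refine ⟨Matrix.GeneralLinearGroup.mkOfDetNeZero !![0, 0, v 0; 1, 0, v 1; 0, 1, v 2] ?_, fun i => ?_⟩
    · rw [Matrix.det_fin_three]; simpa using ha
    · fin_cases i <;> rfl
  · refine ⟨Matrix.GeneralLinearGroup.mkOfDetNeZero !![1, 0, v 0; 0, 0, v 1; 0, 1, v 2] ?_, fun i => ?_⟩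
    · rw [Matrix.det_fin_three]; simpa using ha
    · fin_cases i <;> rfl
  · refine ⟨Matrix.GeneralLinearGroup.mkOfDetNeZero !![1, 0, v 0; 0, 1, v 1; 0, 0, v 2] ?_, fun i => ?_⟩
    · rw [Matrix.det_fin_three]; simpa using ha
    · fin_cases i <;> rfl

/-- If the last column of `g ∈ GL₃(K)` is an eigenvector of `X` for `λ`, then `g⁻¹ X g` has last column `(0, 0, λ)ᵀ`. [folklore] -/
theorem conj_apply_two_of_eigenvector {X : Matrix (Fin 3) (Fin 3) K} {v : Fin 3 → K} {a : K} (hXv : X *ᵥ v = a • v) {g : GL (Fin 3) K}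
    (hg : ∀ i, (g : Matrix (Fin 3) (Fin 3) K) i 2 = v i) (i : Fin 3) :
    (((g⁻¹ : GL (Fin 3) K) : Matrix (Fin 3) (Fin 3) K) * X * (g : Matrix (Fin 3) (Fin 3) K)) i 2 = a * (1 : Matrix (Fin 3) (Fin 3) K) i 2 := by
  have hcol : ∀ k, (X * (g : Matrix (Fin 3) (Fin 3) K)) k 2 = a * (g : Matrix (Fin 3) (Fin 3) K) k 2 := by
    intro k
    have h := congrFun hXv k
    simp only [Matrix.mulVec, dotProduct, Pi.smul_apply, smul_eq_mul] at h
    rw [Matrix.mul_apply]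
    simp_rw [hg]
    rw [h]
  have hgg : ((g⁻¹ : GL (Fin 3) K) : Matrix (Fin 3) (Fin 3) K) * (g : Matrix (Fin 3) (Fin 3) K) = 1 := by
    rw [← Units.val_mul, inv_mul_cancel, Units.val_one]
  rw [Matrix.mul_assoc, Matrix.mul_apply]
  simp_rw [hcol]
  rw [← hgg, Matrix.mul_apply, Finset.mul_sum]
  refine Finset.sum_congr rfl fun k _ => ?_
  ring

/-- **S″ (the head).**  A `3 × 3` matrix over a field `K` whose characteristic polynomial has a SIMPLE root `λ ∈ K` is `GL₃(K)`-conjugate to a Levi block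
form `M(m) = !![m 0, m 1, 0; m 2, m 3, 0; 0, 0, m 4]` with `m 4 = λ`. [cite: HarishChandra1999AdmissibleDistributions, §7] -/
theorem exists_conj_leviBlock_of_isRoot_of_derivative_ne_zero (X : Matrix (Fin 3) (Fin 3) K) (a : K) (ha : X.charpoly.IsRoot a)
    (ha' : X.charpoly.derivative.eval a ≠ 0) :
    ∃ (g : GL (Fin 3) K) (m : Fin 5 → K), m 4 = a ∧
      X = (g : Matrix (Fin 3) (Fin 3) K) * !![m 0, m 1, 0; m 2, m 3, 0; 0, 0, m 4] * ((g⁻¹ : GL (Fin 3) K) : Matrix (Fin 3) (Fin 3) K) := by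
  -- (1) an eigenvector
  have hdet : (Matrix.scalar (Fin 3) a - X).det = 0 := by rw [← Matrix.eval_charpoly]; exact ha
  obtain ⟨v, hv0, hv⟩ := Matrix.exists_mulVec_eq_zero_iff.2 hdet
  have hXv : X *ᵥ v = a • v := by
    rw [Matrix.sub_mulVec, sub_eq_zero] at hv
    rw [← hv]
    ext j
    simp [Matrix.scalar_apply, Matrix.mulVec_diagonal]
  -- (2) `g₁` with last column `v`; (3) `X₁ = g₁⁻¹ X g₁ = [[A, 0], [r, a]]`
  obtain ⟨g₁, hg₁⟩ := exists_gl_apply_two_eq hv0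
  set X₁ : Matrix (Fin 3) (Fin 3) K := ((g₁⁻¹ : GL (Fin 3) K) : Matrix (Fin 3) (Fin 3) K) * X * (g₁ : Matrix (Fin 3) (Fin 3) K) with hX₁
  have hc : ∀ i, X₁ i 2 = a * (1 : Matrix (Fin 3) (Fin 3) K) i 2 := fun i => conj_apply_two_of_eigenvector hXv hg₁ i
  have h02 : X₁ 0 2 = 0 := by rw [hc]; simp
  have h12 : X₁ 1 2 = 0 := by rw [hc]; simp
  have h22 : X₁ 2 2 = a := by rw [hc]; simp
  -- `χ_X = χ_{X₁} = χ_A · (t − a)`, so `χ_A(a) ≠ 0`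
  set A : Matrix (Fin 2) (Fin 2) K := !![X₁ 0 0, X₁ 0 1; X₁ 1 0, X₁ 1 1] with hA
  have hχ : X.charpoly = X₁.charpoly := by rw [hX₁, Matrix.coe_units_inv, Matrix.charpoly_units_conj']
  have hAa : A.charpoly.eval a ≠ 0 := by
    have h := derivative_charpoly_eval_of_col_two_eq_zero X₁ h02 h12
    rw [h22, ← hχ] at h
    rwa [h] at ha'
  -- explicit entries; `δ := χ_A(a) = (a − x₀₀)(a − x₁₁) − x₀₁ x₁₀ ≠ 0`
  set x00 := X₁ 0 0 with hx00
  set x01 := X₁ 0 1 with hx01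
  set x10 := X₁ 1 0 with hx10
  set x11 := X₁ 1 1 with hx11
  set r0 := X₁ 2 0 with hr0
  set r1 := X₁ 2 1 with hr1
  have hδ : (a - x00) * (a - x11) - x01 * x10 ≠ 0 := by
    have h : A.charpoly.eval a = (a - x00) * (a - x11) - x01 * x10 := by
      rw [hA, Matrix.eval_charpoly, Matrix.det_fin_two]
      simp [Matrix.scalar_apply, Matrix.diagonal]
    rwa [h] at hAa
  -- the shear parameters `z = r · (a·1 − A)⁻¹` (Cramer, `2 × 2`)
  set z0 : K := (r0 * (a - x11) + r1 * x10) / ((a - x00) * (a - x11) - x01 * x10) with hz0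
  set z1 : K := (r0 * x01 + r1 * (a - x00)) / ((a - x00) * (a - x11) - x01 * x10) with hz1
  have e0 : z0 * (a - x00) - z1 * x10 = r0 := by
    rw [hz0, hz1, div_mul_eq_mul_div, div_mul_eq_mul_div, div_sub_div_same, div_eq_iff hδ]
    ring
  have e1 : z1 * (a - x11) - z0 * x01 = r1 := by
    rw [hz0, hz1, div_mul_eq_mul_div, div_mul_eq_mul_div, div_sub_div_same, div_eq_iff hδ]
    ring
  -- the shear `h = [[1,0,0],[0,1,0],[z₀,z₁,1]]` as a unit
  let hU : GL (Fin 3) K :=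
    ⟨!![1, 0, 0; 0, 1, 0; z0, z1, 1], !![1, 0, 0; 0, 1, 0; -z0, -z1, 1],
      by ext i j; fin_cases i <;> fin_cases j <;> simp [Matrix.mul_apply, Fin.sum_univ_three],
      by ext i j; fin_cases i <;> fin_cases j <;> simp [Matrix.mul_apply, Fin.sum_univ_three]⟩
  have hhU : (hU : Matrix (Fin 3) (Fin 3) K) = !![1, 0, 0; 0, 1, 0; z0, z1, 1] := rfl
  have hhUinv : ((hU⁻¹ : GL (Fin 3) K) : Matrix (Fin 3) (Fin 3) K) = !![1, 0, 0; 0, 1, 0; -z0, -z1, 1] := rfl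
  -- (4) `h X₁ h⁻¹ = M(m)`
  set m : Fin 5 → K := ![x00, x01, x10, x11, a] with hm
  have hX₁e : X₁ = !![x00, x01, 0; x10, x11, 0; r0, r1, a] := by
    ext i j
    fin_cases i <;> fin_cases j <;> simp [hx00, hx01, hx10, hx11, hr0, hr1, h02, h12, h22]
  have hconj : (hU : Matrix (Fin 3) (Fin 3) K) * X₁ * ((hU⁻¹ : GL (Fin 3) K) : Matrix (Fin 3) (Fin 3) K) =
      !![m 0, m 1, 0; m 2, m 3, 0; 0, 0, m 4] := by
    rw [hhU, hhUinv, hX₁e]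
    ext i j
    fin_cases i <;> fin_cases j <;> simp [Matrix.mul_apply, Fin.sum_univ_three, hm] <;>
      first | linear_combination (-1 : K) * e0 | linear_combination (-1 : K) * e1
  -- assemble: `g := g₁ h⁻¹`
  have hGG : (g₁ : Matrix (Fin 3) (Fin 3) K) * ((g₁⁻¹ : GL (Fin 3) K) : Matrix (Fin 3) (Fin 3) K) = 1 := by
    rw [← Units.val_mul, mul_inv_cancel, Units.val_one]
  have hHH : ((hU⁻¹ : GL (Fin 3) K) : Matrix (Fin 3) (Fin 3) K) * (hU : Matrix (Fin 3) (Fin 3) K) = 1 := by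
    rw [← Units.val_mul, inv_mul_cancel, Units.val_one]
  have hX : X = (g₁ : Matrix (Fin 3) (Fin 3) K) * X₁ * ((g₁⁻¹ : GL (Fin 3) K) : Matrix (Fin 3) (Fin 3) K) := by
    rw [hX₁]
    simp only [← Matrix.mul_assoc, hGG, Matrix.one_mul]
    rw [Matrix.mul_assoc, hGG, Matrix.mul_one]
  have hX₁' : X₁ = ((hU⁻¹ : GL (Fin 3) K) : Matrix (Fin 3) (Fin 3) K) * !![m 0, m 1, 0; m 2, m 3, 0; 0, 0, m 4] * (hU : Matrix (Fin 3) (Fin 3) K) := by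
    rw [← hconj]
    simp only [← Matrix.mul_assoc, hHH, Matrix.one_mul]
    rw [Matrix.mul_assoc, hHH, Matrix.mul_one]
  refine ⟨g₁ * hU⁻¹, m, by simp [hm], ?_⟩
  rw [mul_inv_rev, inv_inv, Units.val_mul, Units.val_mul, hX, hX₁']
  simp only [Matrix.mul_assoc]

end Field

end Summit.HodgeConjecture.HodgeConjecture.Cruxes.H413.K2E3GL3SimpleEigenvalueLeviForm

end
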